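/- LEAD seat `ym-line-cbag-p1` (prover-ym-line-cbag-p1-g29-0), LINE 7b (`GlueballBandRecursion`, volume-comparison line): the ANALYTIC half of the
line's assembly — the tube rate as a named holomorphic limit, the thermal free energy at real coupling, and the Schwarz-lemma step «jets ⇒ estimate».
Sorry-free; `--supports stmt-QuantumFields-22957 --as helper`.  Sequel: `…VolumeComparisonOfJets.lean` (the assembly proper). -/
import Summits.QuantumFields.YangMills.Theorems.GlueballBandRecursionThermalFreeEnergyDefs
import HarnessLib

/-!
# Route `GlueballBandRecursion`, line 7b: the thermal free energy of the spatial torus — limit, holomorphy, real coupling, Schwarz step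

Objects (`…ThermalFreeEnergyDefs`): `tubeLogZ ρ a t z = log Z(a³×t)(z)` (the cluster-expansion logarithm of the periodic box `a×a×a×t`),
`tubeRate ρ a z = e_a(z)` (the tube rate), `thermalLogZ ρ a t z = log Z(a³×t)(z) − t e_a(z)`, `volumeDiscrepancy ρ a a' t z =
thermalLogZ ρ a' t z/a'³ − thermalLogZ ρ a t z/a³`.  Proved here, for a compact group `G` and a continuous (unitary where stated) `ρ`, with
`r_ρ = strongCouplingRadius ρ`:

* §1 the tube rate IS the limit of `log Z(a³×(k+1))/(k+1)` with the tree's rate: `‖log Z(a³×t)(z) − t e_a(z)‖ ≤ 12a³te^{−⌊t/2⌋}` on `‖z‖ ≤ r_ρ`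
  (`tubeRate_spec`, `norm_thermalLogZ_le`, from `PeriodicBoxFreeEnergyLimits.exists_tube_rate` + uniqueness of limits); `log Z`, `e_a`, the thermal
  free energy and the volume discrepancy are holomorphic on the open disc (`differentiableOn_…`, locally uniform limits); `‖volumeDiscrepancy‖ ≤ 24t`;
* §2 at real `0 ≤ β ≤ r_ρ`: `Re log Z(a³×t)(β) = log cyclicPartition ρ β a t`, `Re e_a(β) = log transferSpectralRadius ρ β a` (spectral squeeze, as in
  module XII), so `Re thermalLogZ ρ a (m+2) β = log(1 + traceExcess ρ β a (m+2))` — the thermal free energy of the spatial torus;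
* §3 SCHWARZ: if `volumeDiscrepancy ρ a a' t =O[𝓝 0] z^k` then `‖volumeDiscrepancy ρ a a' t z‖ ≤ 24t·(‖z‖/(r_ρ/2))^k` for `‖z‖ ≤ r_ρ/2`
  (`StrongCouplingInfiniteVolume.norm_le_of_isBigO_pow`) — per-volume Taylor-order information becomes a volume-uniform estimate.

HONEST FRAMING.  Plumbing for the ∃-window strong-coupling rung (RECORD-type); nothing bears on weak coupling or on the Yang–Mills mass gap (Clay),
which is NOT proved by anything in this file.
-/

set_option autoImplicit false

noncomputable section

open Filter Topology Asymptotics MeasureTheory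
open Literature.Probability.LatticeModels (pertLogZ)
open Literature.MathematicalPhysics.QuantumFieldTheory
open Literature.MathematicalPhysics.QuantumFieldTheory.Balaban1983to89.Missing

namespace Summit.QuantumFields.YangMills.Theorems.GlueballBandRecursion.Thermal

/-! ## §1 The tube rate as a limit; bounds and holomorphy on the strong-coupling disc -/

section Analytic

variable {G : Type*} [Group G] [TopologicalSpace G] [IsTopologicalGroup G] [CompactSpace G] [MeasurableSpace G] [BorelSpace G]
  {n : ℕ} (ρ : G →* Matrix (Fin n) (Fin n) ℂ)

/-- **The tube rate is the limit, with the tree's rate.**  For continuous `ρ`, `a ≥ 1`, `‖z‖ ≤ r_ρ`: `log Z(a³×(k+1))(z)/(k+1) → e_a(z)` and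
`‖log Z(a³×t)(z) − t·e_a(z)‖ ≤ 12a³te^{−⌊t/2⌋}` for all `t ≥ 1` (from `exists_tube_rate` and uniqueness of limits). -/
theorem tubeRate_spec (hρ : Continuous ρ) {a : ℕ} (ha : 0 < a) {z : ℂ} (hz : ‖z‖ ≤ strongCouplingRadius ρ) :
    Tendsto (fun k : ℕ => tubeLogZ ρ a (k + 1) z / ((k + 1 : ℕ) : ℂ)) atTop (𝓝 (tubeRate ρ a z)) ∧
      ∀ t : ℕ, 1 ≤ t → ‖tubeLogZ ρ a t z - (t : ℂ) * tubeRate ρ a z‖ ≤ 12 * (a : ℝ) ^ 3 * t * Real.exp (-((t / 2 : ℕ) : ℝ)) := by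
  obtain ⟨e, he⟩ := exists_tube_rate (G := G) hρ (strongCouplingRadius_mul_costBound_le_one ρ)
    (strongCouplingRadius_smallness ρ) ha
  set u : ℕ → ℂ := fun k => tubeLogZ ρ a (k + 1) z / ((k + 1 : ℕ) : ℂ) with hu
  -- `‖u k − e z‖ ≤ 12 a³ e^{−⌊(k+1)/2⌋}`
  have hb : ∀ k : ℕ, ‖u k - e z‖ ≤ 12 * (a : ℝ) ^ 3 * Real.exp (-(((k + 1) / 2 : ℕ) : ℝ)) := by
    intro k
    have hk0 : ((k + 1 : ℕ) : ℂ) ≠ 0 := by exact_mod_cast (show k + 1 ≠ 0 by omega)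
    refine norm_div_sub_le_of_norm_sub_mul_le hk0 ?_
    have h := he (k + 1) (by omega) z hz
    rw [Complex.norm_natCast]
    refine (le_of_eq (by rfl)).trans (h.trans (le_of_eq ?_))
    push_cast; ring
  have htend : Tendsto u atTop (𝓝 (e z)) := by
    rw [tendsto_iff_norm_sub_tendsto_zero]
    exact squeeze_zero (fun k => norm_nonneg _) hb (tendsto_exp_neg_half_floor _)
  have hlim : tubeRate ρ a z = e z := htend.limUnder_eq
  refine ⟨hlim ▸ htend, fun t ht => ?_⟩
  rw [hlim]
  exact he t ht z hz

/-- **The tube-rate bound for the thermal free energy**: `‖thermalLogZ ρ a t z‖ ≤ 12a³te^{−⌊t/2⌋}` on `‖z‖ ≤ r_ρ` (`a, t ≥ 1`). -/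
theorem norm_thermalLogZ_le (hρ : Continuous ρ) {a t : ℕ} (ha : 0 < a) (ht : 1 ≤ t) {z : ℂ} (hz : ‖z‖ ≤ strongCouplingRadius ρ) :
    ‖thermalLogZ ρ a t z‖ ≤ 12 * (a : ℝ) ^ 3 * t * Real.exp (-((t / 2 : ℕ) : ℝ)) :=
  (tubeRate_spec ρ hρ ha hz).2 t ht

/-- `‖thermalLogZ ρ a t z‖/a³ ≤ 12 t` on the disc. -/
theorem norm_thermalLogZ_div_le (hρ : Continuous ρ) {a t : ℕ} (ha : 0 < a) (ht : 1 ≤ t) {z : ℂ} (hz : ‖z‖ ≤ strongCouplingRadius ρ) :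
    ‖thermalLogZ ρ a t z / ((a : ℂ) ^ 3)‖ ≤ 12 * (t : ℝ) := by
  have ha3 : (0 : ℝ) < (a : ℝ) ^ 3 := by positivity
  rw [norm_div, norm_pow, Complex.norm_natCast, div_le_iff₀ ha3]
  refine (norm_thermalLogZ_le ρ hρ ha ht hz).trans ?_
  have h1 : Real.exp (-((t / 2 : ℕ) : ℝ)) ≤ 1 := Real.exp_le_one_iff.2 (by simp)
  have h0 : (0 : ℝ) ≤ 12 * (a : ℝ) ^ 3 * t := by positivity
  nlinarith [mul_le_mul_of_nonneg_left h1 h0]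

/-- `‖volumeDiscrepancy ρ a a' t z‖ ≤ 24 t` on the disc (`a, a', t ≥ 1`). -/
theorem norm_volumeDiscrepancy_le (hρ : Continuous ρ) {a a' t : ℕ} (ha : 0 < a) (ha' : 0 < a') (ht : 1 ≤ t) {z : ℂ}
    (hz : ‖z‖ ≤ strongCouplingRadius ρ) : ‖volumeDiscrepancy ρ a a' t z‖ ≤ 24 * (t : ℝ) := by
  unfold volumeDiscrepancy
  refine (norm_sub_le _ _).trans ?_
  have h1 := norm_thermalLogZ_div_le ρ hρ ha' ht hz
  have h2 := norm_thermalLogZ_div_le ρ hρ ha ht hz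
  linarith

/-- `log Z(a³×t)` is holomorphic on the open strong-coupling disc. -/
theorem differentiableOn_tubeLogZ (hρ : Continuous ρ) (a t : ℕ) :
    DifferentiableOn ℂ (tubeLogZ ρ a t) (Metric.ball 0 (strongCouplingRadius ρ)) := by
  classical
  have hR := boxSystem_regular (d := 4) (G := G) ρ hρ (![a, a, a, t] : Fin 4 → ℕ)
  have hr1 : Real.exp 1 * (2 * costBound ρ * strongCouplingRadius ρ) * ((boxDeg 4 : ℝ) + 1) ^ 2 ≤ 1 / 2 :=
    PlaqSystem.smallness_one_of_two (D := boxDeg 4) (ε := 2 * costBound ρ * strongCouplingRadius ρ)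
      (by have := costBound_pos ρ; have := strongCouplingRadius_pos ρ; positivity) (strongCouplingRadius_smallness ρ)
  have h := PlaqSystem.differentiableOn_pertLogZ hR (r := strongCouplingRadius ρ) (strongCouplingRadius_mul_costBound_le_one ρ) hr1
    Finset.univ
  refine h.congr fun z _ => ?_
  unfold tubeLogZ
  congr

/-- The tube rate `e_a` is holomorphic on the open strong-coupling disc (locally uniform limit of holomorphic functions). -/
theorem differentiableOn_tubeRate (hρ : Continuous ρ) {a : ℕ} (ha : 0 < a) :
    DifferentiableOn ℂ (tubeRate ρ a) (Metric.ball 0 (strongCouplingRadius ρ)) := by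
  set u : ℕ → ℂ → ℂ := fun k z => tubeLogZ ρ a (k + 1) z / ((k + 1 : ℕ) : ℂ) with hu
  set b : ℕ → ℝ := fun k => 12 * (a : ℝ) ^ 3 * Real.exp (-(((k + 1) / 2 : ℕ) : ℝ)) with hb
  have hbound : ∀ z : ℂ, ‖z‖ ≤ strongCouplingRadius ρ → ∀ k, ‖u k z - tubeRate ρ a z‖ ≤ b k := by
    intro z hz k
    have hk0 : ((k + 1 : ℕ) : ℂ) ≠ 0 := by exact_mod_cast (show k + 1 ≠ 0 by omega)
    refine norm_div_sub_le_of_norm_sub_mul_le hk0 ?_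
    have h := (tubeRate_spec ρ hρ ha hz).2 (k + 1) (by omega)
    rw [Complex.norm_natCast]
    refine h.trans (le_of_eq ?_)
    rw [hb]; push_cast; ring
  have hunif : TendstoUniformlyOn u (tubeRate ρ a) atTop (Metric.closedBall 0 (strongCouplingRadius ρ)) := by
    refine Metric.tendstoUniformlyOn_iff.2 fun ε hε => ?_
    filter_upwards [(tendsto_exp_neg_half_floor (12 * (a : ℝ) ^ 3)).eventually (gt_mem_nhds hε)] with k hk z hz
    rw [Metric.mem_closedBall, dist_zero_right] at hz
    rw [dist_comm, dist_eq_norm]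
    exact lt_of_le_of_lt (hbound z hz k) hk
  have hdiff : ∀ k, DifferentiableOn ℂ (u k) (Metric.ball 0 (strongCouplingRadius ρ)) := fun k =>
    (differentiableOn_tubeLogZ ρ hρ a (k + 1)).div_const _
  exact (hunif.mono Metric.ball_subset_closedBall).tendstoLocallyUniformlyOn.differentiableOn
    (Filter.Eventually.of_forall hdiff) Metric.isOpen_ball

/-- The thermal free energy is holomorphic on the open strong-coupling disc. -/
theorem differentiableOn_thermalLogZ (hρ : Continuous ρ) {a : ℕ} (ha : 0 < a) (t : ℕ) :
    DifferentiableOn ℂ (thermalLogZ ρ a t) (Metric.ball 0 (strongCouplingRadius ρ)) := by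
  have h := (differentiableOn_tubeLogZ ρ hρ a t).sub ((differentiableOn_tubeRate ρ hρ ha).const_mul (t : ℂ))
  exact h.congr fun z _ => rfl

/-- The volume discrepancy is holomorphic on the open strong-coupling disc. -/
theorem differentiableOn_volumeDiscrepancy (hρ : Continuous ρ) {a a' : ℕ} (ha : 0 < a) (ha' : 0 < a') (t : ℕ) :
    DifferentiableOn ℂ (volumeDiscrepancy ρ a a' t) (Metric.ball 0 (strongCouplingRadius ρ)) := by
  have h := ((differentiableOn_thermalLogZ ρ hρ ha' t).div_const ((a' : ℂ) ^ 3)).sub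
    ((differentiableOn_thermalLogZ ρ hρ ha t).div_const ((a : ℂ) ^ 3))
  exact h.congr fun z _ => rfl

end Analytic

/-! ## §2 Real coupling: the thermal free energy is `log(1 + traceExcess)` -/

section RealCoupling

variable {G : Type*} [Group G] [TopologicalSpace G] [IsTopologicalGroup G] [CompactSpace G] [MeasurableSpace G] [BorelSpace G]
  [SecondCountableTopology G] {n : ℕ} (ρ : G →* Matrix (Fin n) (Fin n) ℂ)

/-- At real `β ∈ [0, r_ρ]`: `Re log Z(a³×t)(β) = log cyclicPartition ρ β a t` (module XII's dictionary). -/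
theorem re_tubeLogZ_ofReal (hρ : Continuous ρ) (hρu : ∀ g, ρ g ∈ Matrix.unitaryGroup (Fin n) ℂ) {β : ℝ} (hβ0 : 0 ≤ β)
    (hβ : β ≤ strongCouplingRadius ρ) (a t : ℕ) [NeZero a] [NeZero t] :
    (tubeLogZ ρ a t (β : ℂ)).re = Real.log (cyclicPartition ρ β a t) := by
  classical
  have hM := costBound_pos ρ
  have hz : ‖(β : ℂ)‖ ≤ strongCouplingRadius ρ := by
    rw [Complex.norm_real, Real.norm_eq_abs, abs_of_nonneg hβ0]; exact hβ
  obtain ⟨hzM, -, hz1⟩ := disc_hypotheses (D := boxDeg 4) hM (strongCouplingRadius_mul_costBound_le_one ρ)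
    (strongCouplingRadius_smallness ρ) hz
  have hR := boxSystem_regular (d := 4) (G := G) ρ hρ (![a, a, a, t] : Fin 4 → ℕ)
  have hZpos := cyclicPartition_pos_of_unitary ρ hρ hρu β a t
  have hre := PlaqSystem.re_pertLogZ_eq_log_norm_partZ hR hzM hz1 Finset.univ
  rw [partZ_boxSystem_ofReal_eq_cyclicPartition ρ hρ hρu β a t, Complex.norm_real, Real.norm_eq_abs, abs_of_pos hZpos] at hre
  unfold tubeLogZ
  convert hre using 2

/-- At real `β ∈ [0, r_ρ]`: `Re e_a(β) = log transferSpectralRadius ρ β a` — the tube rate is the logarithm of the top transfer eigenvalue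
(spectral squeeze `λ₊^{m+2} ≤ Z(m+2) ≤ λ₊^m Z(2)` against the uniform-in-the-period tube bound, as in module XII). -/
theorem re_tubeRate_ofReal (hρ : Continuous ρ) (hρu : ∀ g, ρ g ∈ Matrix.unitaryGroup (Fin n) ℂ) {β : ℝ} (hβ0 : 0 ≤ β)
    (hβ : β ≤ strongCouplingRadius ρ) (a : ℕ) [NeZero a] :
    (tubeRate ρ a (β : ℂ)).re = Real.log (transferSpectralRadius ρ β a) := by
  have hz : ‖(β : ℂ)‖ ≤ strongCouplingRadius ρ := by
    rw [Complex.norm_real, Real.norm_eq_abs, abs_of_nonneg hβ0]; exact hβ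
  have hspec := (tubeRate_spec ρ hρ (Nat.pos_of_ne_zero (NeZero.ne a)) hz).2
  set E : ℝ := (tubeRate ρ a (β : ℂ)).re with hEdef
  -- the real form of the tube bound
  have hE : ∀ T : ℕ, |Real.log (cyclicPartition ρ β a (T + 2)) - ((T : ℝ) + 2) * E| ≤
      12 * (a : ℝ) ^ 3 * ((T : ℝ) + 2) * Real.exp (-(((T + 2) / 2 : ℕ) : ℝ)) := by
    intro T
    have h1 := hspec (T + 2) (by omega)
    have hsub : (tubeLogZ ρ a (T + 2) (β : ℂ) - ((T + 2 : ℕ) : ℂ) * tubeRate ρ a (β : ℂ)).re =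
        Real.log (cyclicPartition ρ β a (T + 2)) - ((T : ℝ) + 2) * E := by
      rw [Complex.sub_re, re_tubeLogZ_ofReal ρ hρ hρu hβ0 hβ a (T + 2), Complex.mul_re, Complex.natCast_re, Complex.natCast_im]
      push_cast
      ring
    rw [← hsub]
    refine (Complex.abs_re_le_norm _).trans (h1.trans (le_of_eq ?_))
    push_cast
    ring
  -- the squeeze (verbatim module XII)
  have hl := transferSpectralRadius_pos_of_unitary ρ hρ hρu hβ0 a
  have hZpos : ∀ m : ℕ, 0 < cyclicPartition ρ β a (m + 2) := fun m => cyclicPartition_pos_of_unitary ρ hρ hρu β a (m + 2)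
  set l : ℝ := Real.log (transferSpectralRadius ρ β a) with hl_def
  set B₀ : ℝ := 48 * Real.exp 1 * (a : ℝ) ^ 3 with hB₀
  have hB : ∀ m : ℕ, 12 * (a : ℝ) ^ 3 * ((m : ℝ) + 2) * Real.exp (-(((m + 2) / 2 : ℕ) : ℝ)) ≤ B₀ := by
    intro m
    have h := tube_error_le_quarter a (m + 2)
    push_cast at h
    have hle : Real.exp (-(1 / 4 * ((m : ℝ) + 2))) ≤ 1 :=
      Real.exp_le_one_iff.2 (by have : (0 : ℝ) ≤ m := Nat.cast_nonneg m; nlinarith)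
    calc 12 * (a : ℝ) ^ 3 * ((m : ℝ) + 2) * Real.exp (-(((m + 2) / 2 : ℕ) : ℝ))
        ≤ 48 * Real.exp 1 * (a : ℝ) ^ 3 * Real.exp (-(1 / 4 * ((m : ℝ) + 2))) := h
      _ ≤ 48 * Real.exp 1 * (a : ℝ) ^ 3 * 1 := by gcongr
      _ = B₀ := by rw [hB₀, mul_one]
  have hlow : ∀ m : ℕ, ((m : ℝ) + 2) * l ≤ Real.log (cyclicPartition ρ β a (m + 2)) := by
    intro m
    have h := Real.log_le_log (pow_pos hl (m + 2)) (pow_transferSpectralRadius_le_cyclicPartition ρ hρ hρu hβ0 a m)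
    rw [Real.log_pow] at h
    push_cast at h
    exact h
  have hup : ∀ m : ℕ, Real.log (cyclicPartition ρ β a (m + 2)) ≤ (m : ℝ) * l + Real.log (cyclicPartition ρ β a 2) := by
    intro m
    have h := Real.log_le_log (hZpos m) (cyclicPartition_le_pow_mul ρ hρ hρu hβ0 a m)
    rw [Real.log_mul (pow_pos hl m).ne' (hZpos 0).ne', Real.log_pow] at h
    exact h
  have hE1 : E - l ≤ 0 := by
    refine nonpos_of_forall_add_two_mul_le (C := Real.log (cyclicPartition ρ β a 2) - 2 * l + B₀) fun m => ?_
    have h := (abs_le.1 ((hE m).trans (hB m))).1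
    have h' := hup m
    nlinarith
  have hE2 : l - E ≤ 0 := by
    refine nonpos_of_forall_add_two_mul_le (C := B₀) fun m => ?_
    have h := (abs_le.1 ((hE m).trans (hB m))).2
    have h' := hlow m
    nlinarith
  linarith

/-- At real `β ∈ [0, r_ρ]`: `Re thermalLogZ ρ a (m+2) β = log(1 + traceExcess ρ β a (m+2))` — the thermal free energy of the spatial torus. -/
theorem re_thermalLogZ_ofReal (hρ : Continuous ρ) (hρu : ∀ g, ρ g ∈ Matrix.unitaryGroup (Fin n) ℂ) {β : ℝ} (hβ0 : 0 ≤ β)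
    (hβ : β ≤ strongCouplingRadius ρ) (a m : ℕ) [NeZero a] :
    (thermalLogZ ρ a (m + 2) (β : ℂ)).re = Real.log (1 + traceExcess ρ β a (m + 2)) := by
  have hl := transferSpectralRadius_pos_of_unitary ρ hρ hρu hβ0 a
  have hZ := cyclicPartition_pos_of_unitary ρ hρ hρu β a (m + 2)
  have hX : 1 + traceExcess ρ β a (m + 2) = cyclicPartition ρ β a (m + 2) / transferSpectralRadius ρ β a ^ (m + 2) := by
    unfold traceExcess; ring
  rw [hX, Real.log_div hZ.ne' (pow_pos hl _).ne', Real.log_pow]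
  unfold thermalLogZ
  rw [Complex.sub_re, re_tubeLogZ_ofReal ρ hρ hρu hβ0 hβ a (m + 2), Complex.mul_re, re_tubeRate_ofReal ρ hρ hρu hβ0 hβ a,
    Complex.natCast_re, Complex.natCast_im]
  push_cast
  ring

end RealCoupling

/-! ## §3 The Schwarz lemma with multiplicity: jets ⇒ a volume-discrepancy bound at real coupling -/

section Schwarz

variable {G : Type*} [Group G] [TopologicalSpace G] [IsTopologicalGroup G] [CompactSpace G] [MeasurableSpace G] [BorelSpace G]
  {n : ℕ} (ρ : G →* Matrix (Fin n) (Fin n) ℂ)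

/-- **Jets ⇒ estimate.**  If the volume discrepancy vanishes to order `k` at `z = 0`, then `‖volumeDiscrepancy ρ a a' t z‖ ≤ 24t·(‖z‖/(r_ρ/2))^k`
for `‖z‖ ≤ r_ρ/2` (holomorphic and bounded by `24t` on the disc of radius `r_ρ`). -/
theorem norm_volumeDiscrepancy_le_of_isBigO (hρ : Continuous ρ) {a a' t k : ℕ} (ha : 0 < a) (ha' : 0 < a') (ht : 1 ≤ t)
    (hO : (fun z : ℂ => volumeDiscrepancy ρ a a' t z) =O[𝓝 (0 : ℂ)] fun z : ℂ => z ^ k)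
    {z : ℂ} (hz : ‖z‖ ≤ strongCouplingRadius ρ / 2) :
    ‖volumeDiscrepancy ρ a a' t z‖ ≤ 24 * (t : ℝ) * (‖z‖ / (strongCouplingRadius ρ / 2)) ^ k := by
  have hr := strongCouplingRadius_pos ρ
  refine norm_le_of_isBigO_pow (differentiableOn_volumeDiscrepancy ρ hρ ha ha' t) (fun w hw => ?_) hO (half_pos hr)
    (half_lt_self hr) hz
  rw [Metric.mem_ball, dist_zero_right] at hw
  exact norm_volumeDiscrepancy_le ρ hρ ha ha' ht hw.le

end Schwarz

end Summit.QuantumFields.YangMills.Theorems.GlueballBandRecursion.Thermal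

end
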